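import Summits.BirchSwinnertonDyer.BirchSwinnertonDyer.Theorems.AlignedTransportAtTwoMainConjectureOfRankZeroBSDAtTwoCubicOffStratumRamification
import HarnessLib

/-!
# Route `AlignedTransportAtTwo`, crux C2 `MainConjectureOfRankZeroBSDAtTwo` (stmt-BirchSwinnertonDyer-22298):
# THE DEDEKIND TABLE OF `2` IN THE CUBIC `2`-TORSION FIELD `ℚ(β)` OFF THE STRATUM — the second prime has `(e, f) = (1, 2)` on `Δ_min ≡ 5 (8)` and
# `(e, f) = (2, 1)` on `Δ_min ≡ 3, 7 (8)`

HONEST FRAMING (cell `bsd-f1-sign2`, WIDTH-5 attached prover seat `bsd-line-att-p5` gen 27 on line `birth` of the lead `bsd-line-att-p2`;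
`--supports` stmt-BirchSwinnertonDyer-22298, closes nothing; BSD is NOT proved by any of this; the crux C2, its verdict «blocked-on
`Rank1Residual.GreenbergMuConjectureIrreducible`» and every registered stub are untouched). THEOREMS ONLY — no definition, no named fact, no `sorry`.
Fourth file of this gen (`…CubicResolventParity` p751095 → `…CubicClosureParity` p751747 → `…CubicOffStratumRamification` p752392 → this): the parity statements of
`…CubicOffStratumRamification` (all `e` odd on `Δ_min ≡ 5 (8)`; an even `e` and all `f` odd on `Δ_min ≡ 3 (4)`) combined with att-p5 g26's count
«exactly two primes above `2` OFF the stratum» (`…CubicPrimesOfEmbeddings.ncard_eq_two_of_not_onKilfordStratumAtTwo`) and the fundamental identity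
`Σ eᵢfᵢ = 3` pin the second prime: together with g26's ON-stratum `(1)(1)(1)` the decomposition of `2` in `ℚ(β)` for a good-ordinary curve with
`E(ℚ)[2] = 0` is read off `Δ_min mod 8` in the kernel.

WHAT.
* `ncard_setOf_mem_eq_card_primesOverFinset` (the tree's set `{v : HeightOneSpectrum (𝓞 F) | p ∈ v}` ↔ Mathlib's `primesOverFinset (p)`);
  `ramificationIdx_mul_inertiaDeg_add_ncard_le` (`e(w)f(w) + #{v ∣ p} ≤ [F:ℚ] + 1`: every other prime contributes `≥ 1` to `Σ eᵢfᵢ`).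
* **`exists_ramificationIdx_eq_two_adjoin_of_minimalDiscriminantInt_emod_four_eq_three`**: good ordinary at `2`, `E(ℚ)[2] = 0`, `Δ_min ≡ 3 (4)` ⟹ a prime
  of `ℚ(β)` above `2` with `e = 2`, `f = 1`.
* **`exists_inertiaDeg_eq_two_adjoin_of_minimalDiscriminantInt_emod_eight_eq_five`**: good ordinary at `2`, `E(ℚ)[2] = 0`, `Δ_min ≡ 5 (8)` ⟹ a prime of
  `ℚ(β)` above `2` with `e = 1`, `f = 2` (all `e` odd; with two primes not all `f` can be odd — parity count `#{v ∣ 2} ≡ 3 (mod 2)` — and `e·f ≤ 2`).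
Nothing is asserted about any seed (no certified seed is OFF the stratum); nothing is closed; BSD is not proved.

References: [NeukirchANT1999] Ch. I §8 Prop. (8.2)–(8.3), §9; [Marcus2018] Ch. 3 Thm. 25; [SilvermanAEC2009] VII.2, VIII.§1; tree: this gen's three files,
g26 p747642 / p746875, g16 `…PadicLetterOnPointsPrimes` (`liesOver_span_of_natCast_mem`).
-/

set_option linter.dupNamespace false
set_option autoImplicit false

noncomputable section

open scoped Classical NumberField nonZeroDivisors

namespace Summit.BirchSwinnertonDyer.BirchSwinnertonDyer.Theorems.AlignedTransportAtTwoCubicOffStratumDedekindTable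

open NumberField IsDedekindDomain
  Summit.BirchSwinnertonDyer.BirchSwinnertonDyer.Theorems.AlignedTransportAtTwoCubicResolventParity
  Summit.BirchSwinnertonDyer.BirchSwinnertonDyer.Theorems.AlignedTransportAtTwoCubicClosureParity
  Summit.BirchSwinnertonDyer.BirchSwinnertonDyer.Theorems.AlignedTransportAtTwoCubicOffStratumRamification

/-! ### The Dedekind table of `2` in `ℚ(β)`: the second prime explicitly -/

section Table

variable {F : Type*} [Field F] [NumberField F]

/-- The height-one primes of `𝓞 F` containing `p` are in bijection with Mathlib's `primesOverFinset (p)`. [folklore] -/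
theorem ncard_setOf_mem_eq_card_primesOverFinset {p : ℕ} (hp : p.Prime) :
    {w : HeightOneSpectrum (𝓞 F) | (p : 𝓞 F) ∈ w.asIdeal}.ncard = (IsDedekindDomain.primesOverFinset (Ideal.span {(p : ℤ)}) (𝓞 F)).card := by
  classical
  haveI : Fact p.Prime := ⟨hp⟩
  have hp0 : (Ideal.span {(p : ℤ)} : Ideal ℤ) ≠ ⊥ := by
    rw [Ne, Ideal.span_singleton_eq_bot]; exact_mod_cast hp.ne_zero
  have hbij : (fun w : HeightOneSpectrum (𝓞 F) => w.asIdeal) '' {w : HeightOneSpectrum (𝓞 F) | (p : 𝓞 F) ∈ w.asIdeal} =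
      ↑(IsDedekindDomain.primesOverFinset (Ideal.span {(p : ℤ)}) (𝓞 F)) := by
    ext P
    constructor
    · rintro ⟨w, hw, rfl⟩
      haveI : w.asIdeal.IsPrime := w.isPrime
      exact (IsDedekindDomain.mem_primesOverFinset_iff hp0 _).mpr
        ⟨w.isPrime, AlignedTransportAtTwoFineRoad.RealKummerLinesPadicLetterOnPointsPrimes.liesOver_span_of_natCast_mem p w hw⟩
    · intro hP
      obtain ⟨hPp, hPl⟩ := (IsDedekindDomain.mem_primesOverFinset_iff hp0 _).mp hP
      have hP0 : P ≠ ⊥ := Ideal.ne_bot_of_liesOver_of_ne_bot hp0 P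
      have hpP : (p : 𝓞 F) ∈ P := by
        have h := (Ideal.mem_of_liesOver P (Ideal.span {(p : ℤ)}) (p : ℤ)).mp (Ideal.mem_span_singleton_self _)
        simpa using h
      exact ⟨⟨P, hPp, hP0⟩, hpP, rfl⟩
  rw [← Set.ncard_coe_finset, ← hbij, Set.ncard_image_of_injective _ fun v w h => HeightOneSpectrum.ext h]

/-- **`e(w)f(w) + (#{v ∣ p} − 1) ≤ [F : ℚ]`**: in the fundamental identity every OTHER prime above `p` contributes at least `1`.
[cite: NeukirchANT1999, Ch. I §8, Prop. (8.2)] -/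
theorem ramificationIdx_mul_inertiaDeg_add_ncard_le {p : ℕ} (hp : p.Prime) (w : HeightOneSpectrum (𝓞 F)) (hw : (p : 𝓞 F) ∈ w.asIdeal) :
    w.asIdeal.ramificationIdx ℤ * w.asIdeal.inertiaDeg ℤ + {v : HeightOneSpectrum (𝓞 F) | (p : 𝓞 F) ∈ v.asIdeal}.ncard ≤
      Module.finrank ℚ F + 1 := by
  classical
  haveI : Fact p.Prime := ⟨hp⟩
  haveI : (Ideal.span {(p : ℤ)}).IsMaximal := Int.ideal_span_isMaximal_of_prime p
  have hp0 : (Ideal.span {(p : ℤ)} : Ideal ℤ) ≠ ⊥ := by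
    rw [Ne, Ideal.span_singleton_eq_bot]; exact_mod_cast hp.ne_zero
  set S := IsDedekindDomain.primesOverFinset (Ideal.span {(p : ℤ)}) (𝓞 F) with hSdef
  haveI : w.asIdeal.IsPrime := w.isPrime
  haveI : w.asIdeal.IsMaximal := w.isMaximal
  haveI hwl := AlignedTransportAtTwoFineRoad.RealKummerLinesPadicLetterOnPointsPrimes.liesOver_span_of_natCast_mem p w hw
  have hwS : w.asIdeal ∈ S := (IsDedekindDomain.mem_primesOverFinset_iff hp0 _).mpr ⟨w.isPrime, hwl⟩
  have hsum := Ideal.sum_ramification_inertia (R := ℤ) (𝓞 F) ℚ F (p := Ideal.span {(p : ℤ)}) hp0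
  have hpos : ∀ P ∈ S, 1 ≤ Ideal.ramificationIdx' (Ideal.span {(p : ℤ)}) P * Ideal.inertiaDeg' (Ideal.span {(p : ℤ)}) P := by
    intro P hP
    obtain ⟨hPp, hPl⟩ := (IsDedekindDomain.mem_primesOverFinset_iff hp0 _).mp hP
    haveI := hPp
    haveI := hPl
    have he : Ideal.ramificationIdx' (Ideal.span {(p : ℤ)}) P ≠ 0 := Ideal.Factors.ramificationIdx_ne_zero (Ideal.span {(p : ℤ)}) ⟨P, hP⟩
    have hf : 0 < Ideal.inertiaDeg' (Ideal.span {(p : ℤ)}) P := Ideal.inertiaDeg'_pos _ P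
    exact Nat.one_le_iff_ne_zero.mpr (mul_ne_zero he hf.ne')
  have hsplit := Finset.add_sum_erase S
    (fun P => Ideal.ramificationIdx' (Ideal.span {(p : ℤ)}) P * Ideal.inertiaDeg' (Ideal.span {(p : ℤ)}) P) hwS
  have hrest : (S.erase w.asIdeal).card ≤
      ∑ P ∈ S.erase w.asIdeal, Ideal.ramificationIdx' (Ideal.span {(p : ℤ)}) P * Ideal.inertiaDeg' (Ideal.span {(p : ℤ)}) P := by
    rw [Finset.card_eq_sum_ones]
    exact Finset.sum_le_sum fun P hP => hpos P (Finset.mem_of_mem_erase hP)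
  have hcard : (S.erase w.asIdeal).card + 1 = S.card := by
    rw [Finset.card_erase_of_mem hwS]; exact Nat.sub_add_cancel (Finset.card_pos.mpr ⟨_, hwS⟩)
  rw [ncard_setOf_mem_eq_card_primesOverFinset hp, ← hcard, ← hsum, ← hsplit,
    Ideal.ramificationIdx'_eq_ramificationIdx (Ideal.span {(p : ℤ)}) w.asIdeal hp0, Ideal.inertiaDeg'_eq_inertiaDeg (Ideal.span {(p : ℤ)}) w.asIdeal]
  omega

end Table

section TableSeed

open Polynomial WeierstrassCurve IntermediateField
  Literature.NumberTheory.EllipticCurves Literature.NumberTheory.EllipticCurves.Greenberg1999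
  Summit.BirchSwinnertonDyer.Rank1Residual.F1Sign2
  Summit.BirchSwinnertonDyer.BirchSwinnertonDyer.Theorems.AlignedTransportAtTwoKilfordStratumShared
  Summit.BirchSwinnertonDyer.BirchSwinnertonDyer.Theorems.AlignedTransportAtTwoCubicKilfordPrimes
  Summit.BirchSwinnertonDyer.BirchSwinnertonDyer.Theorems.AlignedTransportAtTwoCubicPrimesOfEmbeddings

variable (W : WeierstrassCurve ℚ) [W.IsElliptic] [W.IsGloballyMinimal]

/-- **`Δ_min ≡ 3 (mod 4)`: the second prime of `ℚ(β)` above `2` has `e = 2`, `f = 1`** (good ordinary at `2`, `E(ℚ)[2] = 0`): a prime with even `e`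
exists, and with two primes above `2` and `Σeᵢfᵢ = 3` its `e·f ≤ 2`. [cite: NeukirchANT1999, Ch. I §8–§9] [cite: Marcus2018, Ch. 3 Thm. 25] -/
theorem exists_ramificationIdx_eq_two_adjoin_of_minimalDiscriminantInt_emod_four_eq_three (hord : IsOrdinaryAt W 2)
    (ht : ∀ x : ℚ, ¬ HasRationalTwoTorsionX W x) (h4 : minimalDiscriminantInt W % 4 = 3)
    {β : AlgebraicClosure ℚ} (hβ : aeval β W.twoTorsionPolynomial.toPoly = 0) :
    ∃ w : HeightOneSpectrum (𝓞 ↥(IntermediateField.adjoin ℚ ({β} : Set (AlgebraicClosure ℚ)))),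
      ((2 : ℕ) : 𝓞 ↥(IntermediateField.adjoin ℚ ({β} : Set (AlgebraicClosure ℚ)))) ∈ w.asIdeal ∧
        w.asIdeal.ramificationIdx ℤ = 2 ∧ w.asIdeal.inertiaDeg ℤ = 1 := by
  obtain ⟨w, hw, heven⟩ := exists_even_ramificationIdx_adjoin_of_minimalDiscriminantInt_emod_four_eq_three W hord ht h4 hβ
  have hirr := AlignedTransportAtTwoSeed.irr_two_of_forall_not_hasRationalTwoTorsionX W ht
  have hβint : IsIntegral ℚ β := ((AlgebraicClosure.isAlgebraic ℚ).isAlgebraic β).isIntegral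
  haveI : FiniteDimensional ℚ ↥(IntermediateField.adjoin ℚ ({β} : Set (AlgebraicClosure ℚ))) :=
    IntermediateField.adjoin.finiteDimensional hβint
  haveI : NumberField ↥(IntermediateField.adjoin ℚ ({β} : Set (AlgebraicClosure ℚ))) := NumberField.mk
  have h3 : Module.finrank ℚ ↥(IntermediateField.adjoin ℚ ({β} : Set (AlgebraicClosure ℚ))) = 3 :=
    AddKatoTwo.finrank_adjoin_root_twoTorsionPolynomial_eq_three W hirr hβ
  have hs : ¬ OnKilfordStratumAtTwo W := (not_onKilfordStratumAtTwo_iff_minimalDiscriminantInt_emod_eight_ne W hord).mpr (by omega)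
  have hn2 := ncard_eq_two_of_not_onKilfordStratumAtTwo _ W hord ht h3 (aeval_four_mul_gen_twoDivisionUCubic W hβ) hs
  have hle := ramificationIdx_mul_inertiaDeg_add_ncard_le Nat.prime_two w hw
  rw [hn2, h3] at hle
  have he0 : 0 < w.asIdeal.ramificationIdx ℤ := Ideal.ramificationIdx_pos w.asIdeal ℤ
  have hf0 : 0 < w.asIdeal.inertiaDeg ℤ := Ideal.inertiaDeg_pos w.asIdeal ℤ
  obtain ⟨k, hk⟩ := heven
  have he2 : 2 ≤ w.asIdeal.ramificationIdx ℤ := by omega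
  have hf1 : w.asIdeal.inertiaDeg ℤ = 1 := by
    by_contra hne
    have h4 : 2 * 2 ≤ w.asIdeal.ramificationIdx ℤ * w.asIdeal.inertiaDeg ℤ := Nat.mul_le_mul he2 (by omega)
    omega
  refine ⟨w, hw, ?_, hf1⟩
  rw [hf1, mul_one] at hle
  omega

/-- **`Δ_min ≡ 5 (mod 8)`: the second prime of `ℚ(β)` above `2` has `e = 1`, `f = 2`** (good ordinary at `2`, `E(ℚ)[2] = 0`): all `e` are odd, there are
two primes above `2`, so not all `f` can be odd (parity count), and `e·f ≤ 2`. [cite: NeukirchANT1999, Ch. I §8–§9] [cite: Marcus2018, Ch. 3 Thm. 25] -/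
theorem exists_inertiaDeg_eq_two_adjoin_of_minimalDiscriminantInt_emod_eight_eq_five (hord : IsOrdinaryAt W 2)
    (ht : ∀ x : ℚ, ¬ HasRationalTwoTorsionX W x) (h8 : minimalDiscriminantInt W % 8 = 5)
    {β : AlgebraicClosure ℚ} (hβ : aeval β W.twoTorsionPolynomial.toPoly = 0) :
    ∃ w : HeightOneSpectrum (𝓞 ↥(IntermediateField.adjoin ℚ ({β} : Set (AlgebraicClosure ℚ)))),
      ((2 : ℕ) : 𝓞 ↥(IntermediateField.adjoin ℚ ({β} : Set (AlgebraicClosure ℚ)))) ∈ w.asIdeal ∧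
        w.asIdeal.ramificationIdx ℤ = 1 ∧ w.asIdeal.inertiaDeg ℤ = 2 := by
  have hodd := forall_odd_ramificationIdx_adjoin_of_minimalDiscriminantInt_emod_eight_eq_five W h8 hβ
  have hirr := AlignedTransportAtTwoSeed.irr_two_of_forall_not_hasRationalTwoTorsionX W ht
  have hβint : IsIntegral ℚ β := ((AlgebraicClosure.isAlgebraic ℚ).isAlgebraic β).isIntegral
  haveI : FiniteDimensional ℚ ↥(IntermediateField.adjoin ℚ ({β} : Set (AlgebraicClosure ℚ))) :=
    IntermediateField.adjoin.finiteDimensional hβint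
  haveI : NumberField ↥(IntermediateField.adjoin ℚ ({β} : Set (AlgebraicClosure ℚ))) := NumberField.mk
  have h3 : Module.finrank ℚ ↥(IntermediateField.adjoin ℚ ({β} : Set (AlgebraicClosure ℚ))) = 3 :=
    AddKatoTwo.finrank_adjoin_root_twoTorsionPolynomial_eq_three W hirr hβ
  have hs : ¬ OnKilfordStratumAtTwo W := (not_onKilfordStratumAtTwo_iff_minimalDiscriminantInt_emod_eight_ne W hord).mpr (by omega)
  have hn2 := ncard_eq_two_of_not_onKilfordStratumAtTwo _ W hord ht h3 (aeval_four_mul_gen_twoDivisionUCubic W hβ) hs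
  -- not every `f` above `2` is odd (else the count of primes above `2` would be odd)
  have hnot : ¬ ∀ w : HeightOneSpectrum (𝓞 ↥(IntermediateField.adjoin ℚ ({β} : Set (AlgebraicClosure ℚ)))),
      ((2 : ℕ) : 𝓞 ↥(IntermediateField.adjoin ℚ ({β} : Set (AlgebraicClosure ℚ)))) ∈ w.asIdeal → Odd (w.asIdeal.inertiaDeg ℤ) := by
    intro hf
    have h := odd_ncard_setOf_mem_of_cubic h3 Nat.prime_two hodd hf
    rw [hn2] at h
    exact absurd h (by decide)
  push Not at hnot
  obtain ⟨w, hw, hfw⟩ := hnot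
  have hle := ramificationIdx_mul_inertiaDeg_add_ncard_le Nat.prime_two w hw
  rw [hn2, h3] at hle
  have he0 : 0 < w.asIdeal.ramificationIdx ℤ := Ideal.ramificationIdx_pos w.asIdeal ℤ
  have hf0 : 0 < w.asIdeal.inertiaDeg ℤ := Ideal.inertiaDeg_pos w.asIdeal ℤ
  rw [Nat.not_odd_iff_even] at hfw
  obtain ⟨k, hk⟩ := hfw
  have hf2 : 2 ≤ w.asIdeal.inertiaDeg ℤ := by omega
  have he1 : w.asIdeal.ramificationIdx ℤ = 1 := by
    by_contra hne
    have h4 : 2 * 2 ≤ w.asIdeal.ramificationIdx ℤ * w.asIdeal.inertiaDeg ℤ := Nat.mul_le_mul (by omega) hf2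
    omega
  refine ⟨w, hw, he1, ?_⟩
  rw [he1, one_mul] at hle
  omega

end TableSeed

end Summit.BirchSwinnertonDyer.BirchSwinnertonDyer.Theorems.AlignedTransportAtTwoCubicOffStratumDedekindTable

end
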